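import Summits.BirchSwinnertonDyer.Rank1Residual.ManinAdditive.CuspidalKummerCubeNoBlindLaws
import Literature.NumberTheory.EllipticCurves.Isogeny
import Literature.NumberTheory.GaloisRepresentations.AbsGaloisGroup
import Mathlib.Algebra.Module.ZLattice.Covolume
import Mathlib.NumberTheory.Padics.PadicNumbers
import HarnessLib
import HarnessLib.Audit.Tags

/-!
# Kernel types of the `3`-edges out of an `X₀(N)`-optimal curve: ASCμ₃ (E-an-99), NB₃^Λ (E-an-100 / E-an-100₉), SCK₃ (E-an-101),
# and the lead's Vélu–Kraus dictionary row (VÉLU₃♯) — the two remaining NB₃-branch inputs of the C3 line `kato_shift_three` v12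
# (cell `bsd-f2-manin`; an g22 MEMO-an §64 + C2/C3 LEAD bsd-line-manin23-p1 g5 T-p1-g5-3 FINAL; typer g13)

HONEST FRAMING.  LENS = analytic / period-lattice (Stevens covolume ledger at 3; `bsd-f2-manin-an` g22) + the lead's local
Vélu/Kraus dictionary at 3.  SOURCES: §0–§3 = HOME/an/Sketch-an-g22.lean e11ba09bb5f32da7 (195 l., farm rc 0 · 0 sorries ·
axioms standard) VERBATIM up to the namespace (`BsdF2ManinAnG22` ↦ `…ManinAdditive.ThreeIsogenyKernel`) and the `@[conjecture]`
tags; §4 = the lead's stub 4b‴ of HOME/p1/Line-kato-shift-three-v12-candidate.lean bca6546f12d33271 (`stub_veluAscendsOfCongruence`)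
as the named law `VeluAscendingEdgeOfCongruenceAtNine`, stated with an's §0 predicates (definitionally the stub's inline
conjunctions — `veluAscendingEdgeOfCongruenceAtNine_expanded` / `noConstantKernelAscendingAtNine_expanded` give the v12 stub
statements VERBATIM, PROVED by unfolding).  VOCABULARY = the tree's Cremona-method words only: `Isogeny W W₂` on geometric
points with its `Γ_ℚ`-action (`Literature…Isogeny`, `…AbsGaloisGroup`), `φ.degree`, Néron period pairs `IsNeronLatticeOf`,
`ZLattice.covolume`, `ModularParametrizationData` with the lattice-optimality clause VERBATIM as in NB₃
(`CuspidalKummerThree.NoBlindThreeTorsionOptimal`), `IsShortThreeTorsion` / `tangentSlope` (`CuspidalKummer`).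
DICTIONARY (lead, NB3-memo-p1-g5.md; 516/516 Hessian pairs + 50 883 census edges): for a rational `T` of order 3 on
`X₀`-optimal `W`, `T` is 3-BLIND ⟺ `W → W/⟨T⟩` has Néron scalar `λ = 3` ⟺ `covol Λ(W/⟨T⟩) = 3·covol Λ(W)` (ASCENDING edge);
hence NB₃ ⟺ NB₃^Λ₉ below modulo the uniformisation dictionary (NOT proved here), and with the lead's THEOREM
`…Theorems.ManinLocalTwoThree.threeBlind_congruence_mod_nine_of_nine_dvd` (p643768, the `z⁹` certificate: blind ⟹
`Y₁ ≡ 4(α/3)³ (mod 9)`) one has **NB₃ ⟸ NB₃^Λ₉ ∧ (VÉLU₃♯)** in three lines (v12's `noBlindThreeTorsionOptimal_of_stubs`; it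
lives on the Theorems side because that theorem's import cone meets the route file — this leaf stays route-independent).
ROWS (`@[conjecture]`, nothing asserted): **E-an-99 `OptimalAscendingThreeKernelIsMu`** (ASCμ₃: an optimal curve ascends at 3
only through `μ₃`; 38/38 ascending 3-edges `N < 5·10⁵`), **E-an-100 `NoConstantKernelAscendingThreeOptimal`** (NB₃^Λ, all `N`;
0/40 684 `ℤ/3`-kernel edges ascend), **E-an-100₉ `NoConstantKernelAscendingThreeOptimalAtNine`** (= v11/v12 stub 4b′; 0/11 789
at additive 3), **E-an-101 `OptimalThreeCoverKernelConstant`** (SCK₃, the Stevens-II shadow), **(VÉLU₃♯)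
`VeluAscendingEdgeOfCongruenceAtNine`** (= v12 stub 4b‴: a rational order-3 point of `E♮` satisfying the `z⁹` congruence spans
an ASCENDING 3-edge with CONSTANT kernel — Vélu 1971 + Kraus 1989 «in print in substance»; lead's closed form
«λ(T) = 3 ⟺ [v₃α = 1 ∧ Y₁ ≡ 4(α/3)³ (9)] ∨ [v₃α ≥ 2 ∧ v₃Y₁ = 2]» 62 522/62 522, the second branch being the non-3-minimal chart;
as a tree row it needs `Isogeny` EXISTENCE for `W → W/⟨T⟩`, which the tree does not construct).  PROVED (an): `μ₃ ≄ ℤ/3`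
(`not_hasConstantKernel_of_hasMuThreeKernel`), ASCμ₃ ⟹ NB₃^Λ ⟹ NB₃^Λ₉, the Stevens-minimal case.  PLACEMENT (an §64.C,
ref1 §R66 Prop 4): Stevens' Conj II ⟹ SCK₃ ⟹ ASCμ₃ ⟹ NB₃^Λ (paper); unconditionally in print only for `J₀(N)` semistable at
`p` [Vatsal2005 Thm 1.1/1.10; Byeon–Yhee 2013] — nothing at `9 ∣ N`: LAWS, beyond-print theorem NO.  BC5: HOME/an/g22/
stevens3-census.out 497d07875b33b188 (116 973 edges; REF1 §R68 replicated 116 973/116 973 by a different method).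
REFUTER VERDICTS: REF1 R-an-39 (§R66 13:51Z light, §R68 15:23Z full): E-an-99/100/100₉/101 SURVIVE, BC7 3/3 CLEAN,
THEOREM S₃ VALID; (VÉLU₃♯): by-name audit REQUESTED (pending at filing; LEAD ask T-p1-g5-3 FINAL 15:14:52Z).
bears_on: stmt-BirchSwinnertonDyer-22968 (C3 `ManinPrimeToThreeAtNine`, line v12 stubs 4b′/4b‴).  PARTITION 0 ·
beyond-print theorem: no · BSD is not proved by this; Manin's conjecture is not proved by this.
-/

set_option autoImplicit false

noncomputable section

open scoped Classical

namespace Summit.BirchSwinnertonDyer.Rank1Residual.ManinAdditive.ThreeIsogenyKernel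

open CongruenceSubgroup WeierstrassCurve
  Literature.NumberTheory.EllipticCurves Literature.NumberTheory.EllipticCurves.ModularForms
  Summit.BirchSwinnertonDyer.Rank1Residual.ManinAdditive
  Summit.BirchSwinnertonDyer.Rank1Residual.ManinAdditive.CuspidalKummer
  Summit.BirchSwinnertonDyer.Rank1Residual.ManinAdditive.CuspidalKummerThree

/-! ## §0 Kernel types of a rational isogeny and ascending `3`-edges (c-free helper predicates) -/

/-- The kernel `E[φ] ⊆ E(ℚ̄)` of the rational isogeny `φ` is a CONSTANT Galois module: every kernel point is fixed by
`Γ_ℚ`, i.e. (Galois descent, `fixedPoints_eq_range_map`) `ker φ` consists of `ℚ`-rational points — for `#ker φ = 3`: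
`ker φ = ⟨T⟩ ≅ ℤ/3` with `T ∈ E(ℚ)` of order `3`. -/
def HasConstantKernel {W W₂ : WeierstrassCurve ℚ} (φ : Isogeny W W₂) : Prop :=
  ∀ P ∈ φ.toAddMonoidHom.ker, ∀ σ : Field.absoluteGaloisGroup ℚ, σ • P = P

/-- The kernel of `φ` is of `μ₃`-TYPE: `Γ_ℚ` acts on `ker φ` through the quadratic character of `ℚ(√−3)`, non-trivially —
`σ` fixes the kernel pointwise iff `σ(√−3) = √−3`, and acts by `−1` otherwise (for `#ker φ = 3`: `ker φ ≅ μ₃` as a Galois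
module; census test: `−3·u(x_T)` is a rational square).  The conjunct `∃ σ, σ • s ≠ s` (`ℚ(√−3) ≠ ℚ` lifted to `Γ_ℚ`) is a
theorem kept inside the predicate so that `μ₃ ≄ ℤ/3` is available to the one-line edges below. -/
def HasMuThreeKernel {W W₂ : WeierstrassCurve ℚ} (φ : Isogeny W W₂) : Prop :=
  ∃ s : AlgebraicClosure ℚ, s ^ 2 = -3 ∧ (∃ σ : Field.absoluteGaloisGroup ℚ, σ • s ≠ s) ∧
    ∀ P ∈ φ.toAddMonoidHom.ker, ∀ σ : Field.absoluteGaloisGroup ℚ,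
      (σ • s = s → σ • P = P) ∧ (σ • s ≠ s → σ • P = -P)

/-- `φ : W → W₂` (both globally minimal, Néron period pairs `L`, `L₂`) is an ASCENDING `3`-edge: `deg φ = 3` and
`covol Λ(W₂) = 3 · covol Λ(W)`, i.e. `φ^*ω₂ = ±3·ω` (Néron scalar `λ = 3`; equivalently the dual `φ̂ : W₂ → W` is étale in
Stevens' sense, `Λ(W₂) ⊂ Λ(W)` of index `3` after the sign).  FHEIGHT `k = +1`. -/
def IsAscendingThreeEdge {W W₂ : WeierstrassCurve ℚ} (φ : Isogeny W W₂) (L L₂ : PeriodPair) : Prop :=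
  φ.degree = 3 ∧ IsNeronLatticeOf (W.baseChange ℂ) L ∧ IsNeronLatticeOf (W₂.baseChange ℂ) L₂ ∧
    ZLattice.covolume L₂.lattice = 3 * ZLattice.covolume L.lattice

/-! ## §1 LAW ASCμ₃: an `X₀(N)`-optimal curve ascends at `3` only through `μ₃` -/

/-- **E-an-99 `OptimalAscendingThreeKernelIsMu` (ASCμ₃; cell bsd-f2-manin MEMO-an §64; DATA LAW implied by Stevens'
Conjecture II — nothing asserted):** `W` globally minimal and `X₀(N)`-optimal (lattice-optimality clause VERBATIM as in
NB₃), `W₂` globally minimal, `φ : W → W₂` an ascending `3`-edge (`deg φ = 3`, `covol Λ(W₂) = 3·covol Λ(W)`); then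
`ker φ` is of `μ₃`-type.  ALL conductors (no `9 ∣ N`).  Census (BC5): 38 / 38 ascending `3`-edges out of optimal curves,
`N < 5·10⁵` (36 at good `3`, 27a1 → 27a3, 54a1 → 54a3), the only other Cremona-ascending row 390150gy1 → gy2 being the
certified optimality erratum E-imc-19 (HOME/an/g22/stevens3-census.out LIST A).  Why it might fail: an optimal `E₀ ≠ E₁`
beyond `5·10⁵` with a non-constant subquotient in `ker(E₁ → E₀)` (a counterexample to Stevens' Conj II of a new kind —
Watkins 2002 p8: 95 classes `E₀ ≠ E₁`, `N ≤ 10⁴`, all conforming). [cite: Vatsal2005, Thm 1.3, Rmk 1.8, Conj 1.9 (shape: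
Stevens' Thm 2.3 / Conj II; the `X₀`-optimal `μ₃` law is the cell's E-an-99, NOT in print)]
Cell bsd-f2-manin row E-an-99 (ASCμ₃); typed VERBATIM from HOME/an/Sketch-an-g22.lean e11ba09bb5f32da7 (typer g13, T-p1-g5-3 / T-an-28·30); REF1 R-an-39 (§R66/§R68): SURVIVES, BC7 CLEAN; nothing asserted.
[conjecture — cell candidate, NOT a tree fact] -/
@[conjecture]
def OptimalAscendingThreeKernelIsMu : Prop :=
  ∀ (W : WeierstrassCurve ℚ) [W.IsElliptic] [W.IsGloballyMinimal] {N : ℕ} [NeZero N]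
    (D : ModularParametrizationData W N),
    (∀ z ∈ D.L.lattice, ∃ w ∈ periodLattice D.f, z = D.c * w) →
    ∀ (W₂ : WeierstrassCurve ℚ) [W₂.IsElliptic] [W₂.IsGloballyMinimal] (φ : Isogeny W W₂) (L₂ : PeriodPair),
      IsAscendingThreeEdge φ D.L L₂ → HasMuThreeKernel φ

/-! ## §2 LAW NB₃^Λ: no ascending `3`-edge out of an optimal curve has constant kernel (the lattice twin of NB₃) -/

/-- **E-an-100 `NoConstantKernelAscendingThreeOptimal` (NB₃^Λ at every `N`; MEMO-an §64; DATA LAW — nothing asserted):**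
`W` globally minimal and `X₀(N)`-optimal, `φ : W → W₂` an ascending `3`-edge to a globally minimal `W₂`; then `ker φ` is
NOT constant (is not generated by a rational point).  Census (BC5): 0 / 40 684 `ℤ/3`-kernel edges out of optimal curves
ascend (good 15 267, mult 13 628, additive 11 789; `N < 5·10⁵`).  By the lead's dictionary its `9 ∣ N` case IS NB₃
(`NoBlindThreeTorsionOptimal`).  Why it might fail: as E-an-99 (it is its corollary, edge below). [cite: Vatsal2005,
Thm 1.3, Conj 1.9 (shape only; the statement is the cell's, NOT in print)]
Cell bsd-f2-manin row E-an-100 (NB₃^Λ, all N); typed VERBATIM from HOME/an/Sketch-an-g22.lean e11ba09bb5f32da7 (typer g13, T-p1-g5-3 / T-an-28·30); REF1 R-an-39 (§R66/§R68): SURVIVES, BC7 CLEAN; nothing asserted.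
[conjecture — cell candidate, NOT a tree fact] -/
@[conjecture]
def NoConstantKernelAscendingThreeOptimal : Prop :=
  ∀ (W : WeierstrassCurve ℚ) [W.IsElliptic] [W.IsGloballyMinimal] {N : ℕ} [NeZero N]
    (D : ModularParametrizationData W N),
    (∀ z ∈ D.L.lattice, ∃ w ∈ periodLattice D.f, z = D.c * w) →
    ∀ (W₂ : WeierstrassCurve ℚ) [W₂.IsElliptic] [W₂.IsGloballyMinimal] (φ : Isogeny W W₂) (L₂ : PeriodPair),
      IsAscendingThreeEdge φ D.L L₂ → ¬ HasConstantKernel φ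

/-- **E-an-100₉ `NoConstantKernelAscendingThreeOptimalAtNine`** — the `9 ∣ N` case of E-an-100 = the period-lattice form
of NB₃ `NoBlindThreeTorsionOptimal` (lead's dictionary: blind ⟺ ascending).  Census: 0 / 11 789 additive-`3` `ℤ/3`-edges
ascend; the 2 genuine ascending additive-`3` edges (27a1, 54a1) have `μ₃` kernels. [cite: Vatsal2005, Conj 1.9 (shape only)]
Cell bsd-f2-manin row E-an-100₉ (NB₃^Λ at 9 ∣ N = C3 line v11/v12 stub 4b′ `stub_noConstantKernelAscendingAtNine`); typed VERBATIM from HOME/an/Sketch-an-g22.lean e11ba09bb5f32da7 (typer g13, T-p1-g5-3 / T-an-28·30); REF1 R-an-39 (§R66/§R68): SURVIVES, BC7 CLEAN; nothing asserted.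
[conjecture — cell candidate, NOT a tree fact] -/
@[conjecture]
def NoConstantKernelAscendingThreeOptimalAtNine : Prop :=
  ∀ (W : WeierstrassCurve ℚ) [W.IsElliptic] [W.IsGloballyMinimal] {N : ℕ} [NeZero N]
    (D : ModularParametrizationData W N),
    (∀ z ∈ D.L.lattice, ∃ w ∈ periodLattice D.f, z = D.c * w) → 9 ∣ N →
    ∀ (W₂ : WeierstrassCurve ℚ) [W₂.IsElliptic] [W₂.IsGloballyMinimal] (φ : Isogeny W W₂) (L₂ : PeriodPair),
      IsAscendingThreeEdge φ D.L L₂ → ¬ HasConstantKernel φ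

/-- `μ₃ ≄ ℤ/3`: a degree-`3` isogeny with `μ₃`-type kernel does not have constant kernel (PROVED; uses only
`deg φ = #ker φ = 3`: a non-zero kernel point `P` has `3P = 0`, and `σP = −P = P` would force `P = 0`). -/
theorem not_hasConstantKernel_of_hasMuThreeKernel {W W₂ : WeierstrassCurve ℚ} (φ : Isogeny W W₂)
    (hdeg : φ.degree = 3) (hμ : HasMuThreeKernel φ) : ¬ HasConstantKernel φ := by
  intro hconst
  obtain ⟨s, -, ⟨σ, hσ⟩, hact⟩ := hμ
  have hcard : Nat.card φ.toAddMonoidHom.ker = 3 := hdeg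
  haveI : Finite φ.toAddMonoidHom.ker := Nat.finite_of_card_ne_zero (by omega)
  have hnt : Nontrivial φ.toAddMonoidHom.ker := Finite.one_lt_card_iff_nontrivial.mp (by omega)
  obtain ⟨⟨P, hP⟩, hP0⟩ := exists_ne (0 : φ.toAddMonoidHom.ker)
  have hneg : σ • P = -P := (hact P hP σ).2 hσ
  have hfix : σ • P = P := hconst P hP σ
  have hPP : P = -P := hfix.symm.trans hneg
  have h2 : (2 : ℕ) • P = 0 := by
    rw [two_nsmul]; exact eq_neg_iff_add_eq_zero.mp hPP
  have h3 : (3 : ℕ) • P = 0 := by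
    have h := addOrderOf_dvd_natCard (⟨P, hP⟩ : φ.toAddMonoidHom.ker)
    rw [hcard, addOrderOf_dvd_iff_nsmul_eq_zero] at h
    simpa using congrArg Subtype.val h
  have hP' : P = 0 := by
    have e : P = (3 : ℕ) • P - (2 : ℕ) • P := by abel
    rw [h3, h2, sub_zero] at e
    exact e
  exact hP0 (Subtype.ext hP')

/-- ASCμ₃ ⟹ NB₃^Λ (PROVED edge: E-an-99 ⟹ E-an-100). -/
theorem noConstantKernelAscending_of_kernelIsMu (h : OptimalAscendingThreeKernelIsMu) :
    NoConstantKernelAscendingThreeOptimal :=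
  fun W _ _ _N _ D hL W₂ _ _ φ L₂ hasc =>
    not_hasConstantKernel_of_hasMuThreeKernel φ hasc.1 (h W D hL W₂ φ L₂ hasc)

/-- NB₃^Λ ⟹ NB₃^Λ₉ (PROVED restriction: E-an-100 ⟹ E-an-100₉). -/
theorem noConstantKernelAscendingAtNine_of_all (h : NoConstantKernelAscendingThreeOptimal) :
    NoConstantKernelAscendingThreeOptimalAtNine :=
  fun W _ _ _N _ D hL _h9 W₂ _ _ φ L₂ hasc => h W D hL W₂ φ L₂ hasc

/-- **Stevens-minimal case (unconditional shape of [Vatsal2005, Thm 1.3] = Stevens' Thm 2.3):** if the optimal curve has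
NO ascending `3`-edge at all (`3 ∤ [Λ(E₀) : Λ(E*)]`, e.g. `E₀ = E*`; all optimal curves `N < 5·10⁵` except the 38 sources
of TABLE 1), NB₃^Λ holds for it vacuously.  Typed as the global implication (PROVED, trivial). -/
theorem noConstantKernelAscending_of_noAscending
    (hno : ∀ (W : WeierstrassCurve ℚ) [W.IsElliptic] [W.IsGloballyMinimal] {N : ℕ} [NeZero N]
      (D : ModularParametrizationData W N),
      (∀ z ∈ D.L.lattice, ∃ w ∈ periodLattice D.f, z = D.c * w) →
      ∀ (W₂ : WeierstrassCurve ℚ) [W₂.IsElliptic] [W₂.IsGloballyMinimal] (φ : Isogeny W W₂) (L₂ : PeriodPair),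
        ¬ IsAscendingThreeEdge φ D.L L₂) :
    NoConstantKernelAscendingThreeOptimal :=
  fun W _ _ _N _ D hL W₂ _ _ φ L₂ hasc _ => hno W D hL W₂ φ L₂ hasc

/-! ## §3 LAW SCK₃: the Stevens-II shadow — étale `3`-covers of an optimal curve have constant kernel -/

/-- **E-an-101 `OptimalThreeCoverKernelConstant` (SCK₃; MEMO-an §64; DATA LAW = the `p = 3` shadow of Stevens'
Conjecture II on `X₀`-optimal curves — nothing asserted):** `W` globally minimal and `X₀(N)`-optimal, `W₂` globally minimal,
`ψ : W₂ → W` of degree `3` with `covol Λ(W₂) = 3·covol Λ(W)` (an ÉTALE `3`-cover: `ψ^*ω = ±ω₂`, `Λ(W₂) ⊂ Λ(W)` of index `3`);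
then `ker ψ` is CONSTANT (`= ⟨T₂⟩`, `T₂ ∈ W₂(ℚ)`).  Under Conj II, `ker ψ` is a Galois quotient of the constant group
`ker(E₁ → E₀) ⊆ ker(Shimura cover)`; Cartier-dual to E-an-99 (Weil pairing).  Census (BC5, indirect through the dual
kernel): 38 / 38.  Why it might fail: as E-an-99. [cite: Vatsal2005, Rmk 1.8, Conj 1.9 (shape: constant kernel of the
Shimura cover / Stevens' Conj II; the `X₀`-optimal degree-3 law is the cell's E-an-101, NOT in print)]
Cell bsd-f2-manin row E-an-101 (SCK₃); typed VERBATIM from HOME/an/Sketch-an-g22.lean e11ba09bb5f32da7 (typer g13, T-p1-g5-3 / T-an-28·30); REF1 R-an-39 (§R66/§R68): SURVIVES, BC7 CLEAN; nothing asserted.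
[conjecture — cell candidate, NOT a tree fact] -/
@[conjecture]
def OptimalThreeCoverKernelConstant : Prop :=
  ∀ (W : WeierstrassCurve ℚ) [W.IsElliptic] [W.IsGloballyMinimal] {N : ℕ} [NeZero N]
    (D : ModularParametrizationData W N),
    (∀ z ∈ D.L.lattice, ∃ w ∈ periodLattice D.f, z = D.c * w) →
    ∀ (W₂ : WeierstrassCurve ℚ) [W₂.IsElliptic] [W₂.IsGloballyMinimal] (ψ : Isogeny W₂ W) (L₂ : PeriodPair),
      ψ.degree = 3 → IsNeronLatticeOf (W₂.baseChange ℂ) L₂ →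
      ZLattice.covolume L₂.lattice = 3 * ZLattice.covolume D.L.lattice → HasConstantKernel ψ

/-! ## §4 (VÉLU₃♯) — the lead's Vélu/Kraus dictionary row (C3 line v12 stub 4b‴), with the v12 stub statements unfolded -/

/-- **(VÉLU₃♯) `VeluAscendingEdgeOfCongruenceAtNine` (C2/C3 LEAD bsd-line-manin23-p1 g5, v12-candidate stub 4b‴
`stub_veluAscendsOfCongruence` bca6546f12d33271, stated with an's §0 predicates; nothing asserted).**  At a datum of level
`9 ∣ N`, a rational point `T = (X₁, Y₁)` of order `3` of the short model `E♮ = E_{W,1}` satisfying the lead's `z⁹` congruence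
`‖(Y₁ − 4(α/3)³)/9‖₃ ≤ 1` (`α = tangentSlope W 1 X₁ Y₁`) spans an ASCENDING `3`-edge with CONSTANT kernel out of `W`: there are a
globally minimal `W₂`, an isogeny `φ : W → W₂` of degree `3` with `Γ_ℚ`-fixed kernel and a Néron period pair `L₂` of `W₂` with
`covol L₂ = 3 · covol D.L` (the Vélu model of `E♮/⟨T⟩` is then non-minimal at `3`, Néron scalar `a(ψ_T) = ±3`).  Vélu 1971 +
Kraus 1989 in substance (lead's closed form «λ(T) = 3 ⟺ [v₃α = 1 ∧ Y₁ ≡ 4(α/3)³ (9)] ∨ [v₃α ≥ 2 ∧ v₃Y₁ = 2]», 62 522/62 522;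
the sub-case `v₃α ≥ 2 ∧ v₃Y₁ ≥ 3` is the non-3-minimal chart); as a tree row it needs the EXISTENCE of `W → W/⟨T⟩` as an
`Isogeny` with a Néron period pair, not constructed in the tree — hence an open obligation node here.  REF1 by-name audit
REQUESTED (pending at filing).
[conjecture — cell candidate (dictionary-grade), NOT a tree fact]
[cite: Velu1971, formulas (isogeny with prescribed finite kernel; shape — the 3-adic minimality clause is the lead's, NOT in print as stated)] -/
@[conjecture]
def VeluAscendingEdgeOfCongruenceAtNine : Prop :=
  ∀ (W : WeierstrassCurve ℚ) [W.IsElliptic] [W.IsGloballyMinimal] {N : ℕ} [NeZero N]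
    (D : ModularParametrizationData W N), 9 ∣ N →
    ∀ X₁ Y₁ : ℚ, IsShortThreeTorsion W 1 X₁ Y₁ →
    ‖(((Y₁ - 4 * (tangentSlope W 1 X₁ Y₁ / 3) ^ 3) / 9 : ℚ) : ℚ_[3])‖ ≤ 1 →
    ∃ (W₂ : WeierstrassCurve ℚ) (_ : W₂.IsElliptic) (_ : W₂.IsGloballyMinimal) (φ : Isogeny W W₂) (L₂ : PeriodPair),
      IsAscendingThreeEdge φ D.L L₂ ∧ HasConstantKernel φ

/-- the v12 stub 4b‴ statement VERBATIM (an's predicates unfolded), from the named law (PROVED by unfolding). -/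
theorem veluAscendingEdgeOfCongruenceAtNine_expanded (h : VeluAscendingEdgeOfCongruenceAtNine) :
    ∀ (W : WeierstrassCurve ℚ) [W.IsElliptic] [W.IsGloballyMinimal] {N : ℕ} [NeZero N]
      (D : ModularParametrizationData W N), 9 ∣ N →
      ∀ X₁ Y₁ : ℚ, IsShortThreeTorsion W 1 X₁ Y₁ →
      ‖(((Y₁ - 4 * (tangentSlope W 1 X₁ Y₁ / 3) ^ 3) / 9 : ℚ) : ℚ_[3])‖ ≤ 1 →
      ∃ (W₂ : WeierstrassCurve ℚ) (_ : W₂.IsElliptic) (_ : W₂.IsGloballyMinimal) (φ : Isogeny W W₂) (L₂ : PeriodPair),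
        (φ.degree = 3 ∧ IsNeronLatticeOf (W.baseChange ℂ) D.L ∧ IsNeronLatticeOf (W₂.baseChange ℂ) L₂ ∧
          ZLattice.covolume L₂.lattice = 3 * ZLattice.covolume D.L.lattice) ∧
        (∀ P ∈ φ.toAddMonoidHom.ker, ∀ σ : Field.absoluteGaloisGroup ℚ, σ • P = P) :=
  fun W _ _ _ _ D h9 X₁ Y₁ hT hc => h W D h9 X₁ Y₁ hT hc

/-- the v11/v12 stub 4b′ statement VERBATIM (an's predicates unfolded), from E-an-100₉ (PROVED by unfolding). -/
theorem noConstantKernelAscendingAtNine_expanded (h : NoConstantKernelAscendingThreeOptimalAtNine) :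
    ∀ (W : WeierstrassCurve ℚ) [W.IsElliptic] [W.IsGloballyMinimal] {N : ℕ} [NeZero N]
      (D : ModularParametrizationData W N),
      (∀ z ∈ D.L.lattice, ∃ w ∈ periodLattice D.f, z = D.c * w) → 9 ∣ N →
      ∀ (W₂ : WeierstrassCurve ℚ) [W₂.IsElliptic] [W₂.IsGloballyMinimal] (φ : Isogeny W W₂) (L₂ : PeriodPair),
        (φ.degree = 3 ∧ IsNeronLatticeOf (W.baseChange ℂ) D.L ∧ IsNeronLatticeOf (W₂.baseChange ℂ) L₂ ∧
          ZLattice.covolume L₂.lattice = 3 * ZLattice.covolume D.L.lattice) →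
        ¬ (∀ P ∈ φ.toAddMonoidHom.ker, ∀ σ : Field.absoluteGaloisGroup ℚ, σ • P = P) :=
  fun W _ _ _ _ D hL h9 W₂ _ _ φ L₂ hasc => h W D hL h9 W₂ φ L₂ hasc

/-- **The NB₃-branch reduction, leaf side (PROVED):** NB₃^Λ₉ ∧ (VÉLU₃♯) exclude every rational order-`3` point of `E♮`
that satisfies the `z⁹` congruence at an optimal datum of level `9 ∣ N`.  (With the lead's THEOREM
`threeBlind_congruence_mod_nine_of_nine_dvd` — blind ⟹ congruence — this is NB₃ `NoBlindThreeTorsionOptimal`; that last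
step is v12's `noBlindThreeTorsionOptimal_of_stubs` on the Theorems side.) -/
theorem no_congruent_threeTorsion_of_laws (h100 : NoConstantKernelAscendingThreeOptimalAtNine)
    (hV : VeluAscendingEdgeOfCongruenceAtNine)
    (W : WeierstrassCurve ℚ) [W.IsElliptic] [W.IsGloballyMinimal] {N : ℕ} [NeZero N]
    (D : ModularParametrizationData W N) (hL : ∀ z ∈ D.L.lattice, ∃ w ∈ periodLattice D.f, z = D.c * w) (h9 : 9 ∣ N)
    (X₁ Y₁ : ℚ) (hT : IsShortThreeTorsion W 1 X₁ Y₁) :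
    ¬ ‖(((Y₁ - 4 * (tangentSlope W 1 X₁ Y₁ / 3) ^ 3) / 9 : ℚ) : ℚ_[3])‖ ≤ 1 := by
  intro hc
  obtain ⟨W₂, _, _, φ, L₂, hasc, hconst⟩ := hV W D h9 X₁ Y₁ hT hc
  exact h100 W D hL h9 W₂ φ L₂ hasc hconst

end Summit.BirchSwinnertonDyer.Rank1Residual.ManinAdditive.ThreeIsogenyKernel

end
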